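import Summits.QuantumFields.YangMills.Theorems.TwistExponentGapKoszulRigidity
import Literature.MathematicalPhysics.QuantumFieldTheory.ConstructiveQFTWave0
import HarnessLib

/-!
# Flat orthogonal lattice connections on the discrete torus: `h⁰ = 0 ⇒ h¹ = 0` (twisted discrete Poincaré lemma)
# (route-independent helper toward the crux `TwistExponentGap.RigidTwistCeiling` ⟨stmt-QuantumFields-24054⟩; free hands of
# width seat ym-line-sfw-p2-w3)

THE OBSERVATION.  For a FLAT connection `A : Edge d S → O(W)` on the discrete torus `(ℤ/S)^d` (flat: the two transports around
every plaquette agree) the covariant shift operators `(U_μ f)(x) = A(x,μ) f(x + e_μ)` on `ℓ²(sites; W)` are pairwise COMMUTING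
linear isometric automorphisms, and the twisted deformation complex of lattice gauge theory at a (twisted-)flat configuration —
`C⁰ = W^{sites} → C¹ = W^{links} → C² = W^{plaquettes}`, `(d⁰ξ)(x,μ) = ξ(x) − A(x,μ)ξ(x+e_μ)`,
`(d¹X)(x,μ,ν) = X_μ(x) + A(x,μ)X_ν(x+e_μ) − X_ν(x) − A(x,ν)X_μ(x+e_ν)` — IS the Koszul complex of `(U_μ − 1)_μ`.  Hence the
tree's `exists_primitive_of_koszul_cocycle` (✓ `TwistExponentGapKoszulRigidity`) gives, with NO comb gauge and NO Künneth
bookkeeping: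

`lattice_cocycle_exact` — if the only covariantly constant section is `0` (`h⁰ = 0`: `∀ f, (∀ x μ, A(x,μ) f(x+e_μ) = f x) → f = 0`),
then every lattice 1-cocycle `X` (`A(x,μ)X_ν(x+e_μ) − X_ν(x) = A(x,ν)X_μ(x+e_ν) − X_μ(x)`) is a coboundary:
`X_μ(x) = A(x,μ)ξ(x+e_μ) − ξ(x)` for some `ξ : sites → W`.  Any dimension `d`, any side `S ≥ 1`, any finite-dimensional real
inner product space `W`, any family of linear isometric automorphisms `A(e)` of `W`.

USE for ⟨24054⟩ (the remaining LOCAL Morse–Bott inequality, see ✓p775343): at a `z`-twisted-flat `U₀` take `W = 𝔤_ρ` with the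
Hilbert–Schmidt inner product and `A(e) = Ad ρ(U₀(e))` (orthogonal); `Ad` kills the central twist, so `A` is flat; a covariantly
constant `f` has `f(x₀)` fixed by `Ad` of the two holonomies through `x₀` in the twisted plane, whose commutator is (a conjugate of)
`z`, so pair-rigidity (finite centraliser) forces `f(x₀) = 0`: `h⁰ = 0`, hence `h¹ = 0` — the kernel of the Hessian of the twisted
action at `U₀` is exactly the gauge directions.  What then still separates ⟨24054⟩ from a proof is ONLY the second-order tangent
calculus of plaquette words in the exponential chart (quantitative inverse-function bookkeeping), recorded as XL by ym-dw-p1 g20.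
HONEST FRAMING: finite-dimensional linear algebra on the lattice; nothing here bears on a summit statement or on the Yang–Mills
mass gap.
-/

set_option autoImplicit false

open scoped BigOperators RealInnerProductSpace
open Literature.MathematicalPhysics.QuantumFieldTheory

namespace Summit.QuantumFields.YangMills.Theorems.TwistExponentGap

/-- Lattice shifts commute: `(x + e_μ) + e_ν = (x + e_ν) + e_μ`. -/
theorem site_shift_shift_comm {d S : ℕ} (x : Site d S) (μ ν : Fin d) :
    (x.shift μ).shift ν = (x.shift ν).shift μ := by
  simp only [Site.shift, add_right_comm]

/-- **Twisted discrete Poincaré lemma on the torus (`h⁰ = 0 ⇒ h¹ = 0`).**  For a flat family of linear isometric automorphisms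
`A(e)` of a finite-dimensional real inner product space `W` on the links of the discrete torus `(ℤ/S)^d` with no non-zero
covariantly constant section, every lattice 1-cocycle is a coboundary. -/
theorem lattice_cocycle_exact {d S : ℕ} [NeZero S] {W : Type*} [NormedAddCommGroup W] [InnerProductSpace ℝ W]
    [FiniteDimensional ℝ W] (A : Edge d S → (W ≃ₗᵢ[ℝ] W))
    (hflat : ∀ (x : Site d S) (μ ν : Fin d) (w : W),
      A (x, μ) (A (x.shift μ, ν) w) = A (x, ν) (A (x.shift ν, μ) w))
    (h0 : ∀ f : Site d S → W, (∀ x μ, A (x, μ) (f (x.shift μ)) = f x) → f = 0)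
    (X : Fin d → Site d S → W)
    (hX : ∀ (x : Site d S) (μ ν : Fin d),
      A (x, μ) (X ν (x.shift μ)) - X ν x = A (x, ν) (X μ (x.shift ν)) - X μ x) :
    ∃ ξ : Site d S → W, ∀ (x : Site d S) (μ : Fin d), X μ x = A (x, μ) (ξ (x.shift μ)) - ξ x := by
  classical
  -- `ℓ²(sites; W)` and the covariant shifts `(U_μ f)(x) = A(x,μ) f(x + e_μ)`
  let sh : Fin d → (Site d S ≃ Site d S) := fun μ => Equiv.addRight (Pi.single μ (1 : ZMod S))
  let U : Fin d → (PiLp 2 (fun _ : Site d S => W) ≃ₗᵢ[ℝ] PiLp 2 (fun _ : Site d S => W)) := fun μ =>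
    (LinearIsometryEquiv.piLpCongrLeft 2 ℝ W (sh μ).symm).trans
      (LinearIsometryEquiv.piLpCongrRight 2 (fun x : Site d S => A (x, μ)))
  have hU : ∀ (μ : Fin d) (f : PiLp 2 (fun _ : Site d S => W)) (x : Site d S), U μ f x = A (x, μ) (f (x.shift μ)) := fun μ f x => rfl
  -- the Koszul hypotheses
  have hcomm : ∀ μ ν (f : PiLp 2 (fun _ : Site d S => W)), U μ (U ν f) = U ν (U μ f) := by
    intro μ ν f
    ext x
    rw [hU, hU, hU, hU, site_shift_shift_comm x ν μ]
    exact hflat x μ ν _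
  have hfix : ∀ f : PiLp 2 (fun _ : Site d S => W), (∀ μ, U μ f = f) → f = 0 := by
    intro f hf
    have h1 : (fun x => f x) = 0 := h0 (fun x => f x) fun x μ => by
      have := congrArg (fun g : PiLp 2 (fun _ : Site d S => W) => g x) (hf μ)
      simpa only [hU] using this
    ext x
    have := congrFun h1 x
    simpa using this
  set c : Fin d → PiLp 2 (fun _ : Site d S => W) := fun μ => WithLp.toLp 2 (X μ) with hc
  have hcapp : ∀ μ (x : Site d S), c μ x = X μ x := fun μ x => rfl
  have hcoc : ∀ μ ν, U μ (c ν) - c ν = U ν (c μ) - c μ := by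
    intro μ ν
    ext x
    simp only [PiLp.sub_apply, hU, hcapp]
    exact hX x μ ν
  obtain ⟨ξ, hξ⟩ := exists_primitive_of_koszul_cocycle U hcomm hfix c hcoc
  refine ⟨fun x => ξ x, fun x μ => ?_⟩
  have := congrArg (fun g : PiLp 2 (fun _ : Site d S => W) => g x) (hξ μ)
  simpa only [PiLp.sub_apply, hU, hcapp] using this

end Summit.QuantumFields.YangMills.Theorems.TwistExponentGap
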